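import Summits.QuantumFields.GaugeBoot.Certificates.SparseReducedWindow
import Summits.QuantumFields.GaugeBoot.Certificates.KZL2rpD4b2509o1000UpDA
import Summits.QuantumFields.GaugeBoot.Certificates.KZL2rpD4b2509o1000UpDB
import HarnessLib

/-!
# Kernel replay of the certsdp certificate `kzL2_D4_b2509o1000_max_rp_G2` — part G: factor-row assembly and objective (gb_lean_emit_win 0.10)

HONEST FRAMING (cell `pub-gaugeboot`): certified bounds on lattice expectations at stated coupling,
gauge group, dimension and torus size; NOT a mass gap, NOT a continuum limit, NOT a string tension;
NOT Yang–Mills-summit-bearing (barriers `FixedCouplingUltralocality`, `PerturbativeInvisibility`).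

Certificate sha256 `4a3f5311894dc6d1b247026855db19eb39f6f8316ad9dd113154b2e09b36219a` (problem `kzL2_D4_b2509o1000_max_rp_G2`, sha256 `ad605867e17f01e88d5754eb5f8e1d89c03c037d8229d1ec71ac58fee801f374`): `GB` = all factor rows (data parts
`Certificates/KZL2rpD4b2509o1000UpD….lean` concatenated), the INTEGER objective row `cZ`, the certified bound `lowerQ`, and the kernel check
`gb_len` (factor rows fit the padded dimension 48). Windows: `Certificates/KZL2rpD4b2509o1000UpA….lean`; assembly + theorems: `Certificates/KZL2rpD4b2509o1000Up.lean`.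
Data/plumbing only; nothing is claimed about lattice gauge theory in this file.
-/

namespace Summit.QuantumFields.GaugeBoot.Certificates.KZL2rpD4b2509o1000Up

noncomputable section

open Summit.QuantumFields.GaugeBoot.Certificates.Sparse

/-- All factor rows (concatenation of the data parts' block lists). -/
def GB : List (List (List ℤ)) := GBa ++ GBb

/-- Objective as a sparse INTEGER row: (-1)·y_1. -/
def cZ : List (ℕ × ℤ) := [(1, Int.negSucc 0)]

/-- The certified lower bound on the objective (exact): `-1114450020113594464662654562247213290285340029607/1578978145087901843235710217391964160000000000000` (≈ -0.7058045886072). -/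
def lowerQ : ℚ := -1114450020113594464662654562247213290285340029607/1578978145087901843235710217391964160000000000000

set_option maxHeartbeats 0 in
/-- Kernel check: every factor row of every block has length `≤ 48`. -/
theorem gb_len : lenCheckAll KZL2rpD4b2509o1000Up.GB 48 70 = true := by
  decide +kernel

end

end Summit.QuantumFields.GaugeBoot.Certificates.KZL2rpD4b2509o1000Up
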